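import Literature.Probability.LatticeModels.LatticeSineGordon
import Summits.QuantumFields.YangMills.Theorems.SmallCircleAnchorAnchorGapStubDebyeScreening3

/-!
# Crux `AnchorGap` (stmt-QuantumFields-11141), line `registered` — the Debye–Hückel covariance for vector charges

Stub DS′ (`stub_debyeScreening`) concerns `k`-component fields with a charge family
`α : Fin M → ℝᵏ`; the Debye–Hückel (quadratic) approximation of the tilt couples the components
through the mass matrix `B = 2ζg² Σ_r c_r α_r α_rᵀ`, which is positive definite (`≥ b₀ > 0`) by the
spanning hypothesis (`debyeForm_pos` of `…StubDebyeScreening4`) but in general NOT isotropic.  The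
Debye–Hückel covariance is the Green's function of the vector operator
`L = (-Δ_N + ε) ⊗ 1 + 1 ⊗ B` on the torus.  This file proves, by an elementary energy /
random-walk argument (no spectral theorem, no operator norms), uniformly in the period `N`:

* `debyeOp_coercive` — `b₀ Σ_x |u(x)|² ≤ ⟨u, L u⟩` (summation by parts
  `gaussianAction_eq_quadraticForm` + `gaussianAction_nonneg` for the Laplacian part, `B ≥ b₀`
  sitewise);
* `debyeOp_ker_eq_zero`, `debyeGreen_exists` — `L` is injective, hence (finite dimension) the
  vector Green's function `u = L⁻¹(δ_y ⊗ v)` exists for every site `y` and source vector `v`;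
* `debyeGreen_decay` — **exponential decay of the Debye–Hückel covariance, uniform in `N`**:
  `|u(x)|² ≤ (|v|²/b₀²) ρ^{2n}`, `ρ = 2d/(2d + b₀) < 1`, whenever `x_{i₀} - y_{i₀}` is not the class
  of an integer of modulus `< n`.  Step `0` is the global `ℓ²` bound `Σ_x |u(x)|² ≤ |v|²/b₀²`
  (coercivity + Cauchy–Schwarz); the induction step pairs the local equation at `x ≠ y` with `u(x)`:
  `(2d + b₀)|u(x)|² ≤ u(x) · Σ_{x' ∼ x} u(x')`, and `|Σ_{x' ∼ x} u(x')|² ≤ (2d)² max_{x' ∼ x} |u(x')|²`.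

With `b₀ = 2ζ₁ g₁² a` (`a` from `debyeForm_pos`) this is the rate `c = -log ρ > 0` of DS′ at the
Gaussian level, uniform in `N`, in `g ∈ [g₁, g₂]`, `ζ ∈ [ζ₁, ζ₀]` and `ε ≥ 0`.
-/

set_option autoImplicit false

noncomputable section

namespace Summit.QuantumFields.YangMills.Theorems.AnchorGap

open MeasureTheory
open Literature.Probability.LatticeModels

/-- **Coercivity of the Debye–Hückel operator.** For `ε ≥ 0` and a mass matrix `B` with
`wᵀ B w ≥ b₀ |w|²`: `b₀ Σ_x Σ_a u(x)_a² ≤ Σ_x Σ_a u(x)_a (L u)(x)_a`, where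
`(L u)(x) = (ε + 2d) u(x) + B u(x) - Σ_i (u(x+eᵢ) + u(x-eᵢ))` — the Laplacian part is the
non-negative Gaussian action (`gaussianAction_eq_quadraticForm`, `gaussianAction_nonneg`), the mass
part is `≥ b₀ |u|²` sitewise. [folklore] -/
theorem debyeOp_coercive :
    ∀ (d N k : ℕ) [NeZero N] (ε b₀ : ℝ), 0 ≤ ε → ∀ (B : Fin k → Fin k → ℝ), (∀ w : Fin k → ℝ, b₀ * ∑ a : Fin k, w a ^ 2 ≤ ∑ a : Fin k, ∑ a' : Fin k, w a * B a a' * w a') → ∀ u : TorusSite d N → Fin k → ℝ, b₀ * ∑ x : TorusSite d N, ∑ a : Fin k, u x a ^ 2 ≤ ∑ x : TorusSite d N, ∑ a : Fin k, u x a * ((ε + 2 * d) * u x a + ∑ a' : Fin k, B a a' * u x a' - ∑ i : Fin d, (u (x + Pi.single i 1) a + u (x - Pi.single i 1) a)) := by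
  intro d N k _ ε b₀ hε B hB u
  -- `⟨u, (-Δ + ε) u⟩ ≥ 0`
  have hlap : 0 ≤ ∑ x : TorusSite d N, ∑ a : Fin k, u x a *
      ((ε + 2 * d) * u x a - ∑ i : Fin d, (u (x + Pi.single i 1) a + u (x - Pi.single i 1) a)) := by
    have h1 := gaussianAction_eq_quadraticForm d N k 1 ε (fun p => u p.1 p.2)
    have h2 := LatticeSineGordon.gaussianAction_nonneg (d := d) (N := N) (k := k) 1 hε (fun p => u p.1 p.2)
    rw [h1, one_pow, mul_one, Fintype.sum_prod_type] at h2
    have : (0 : ℝ) < 2⁻¹ := by norm_num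
    exact nonneg_of_mul_nonneg_right (by simpa using h2) this
  -- `⟨u, B u⟩ ≥ b₀ |u|²` sitewise
  have hBsum : b₀ * ∑ x : TorusSite d N, ∑ a : Fin k, u x a ^ 2 ≤
      ∑ x : TorusSite d N, ∑ a : Fin k, u x a * ∑ a' : Fin k, B a a' * u x a' := by
    rw [Finset.mul_sum]
    refine Finset.sum_le_sum fun x _ => (hB (u x)).trans (le_of_eq ?_)
    refine Finset.sum_congr rfl fun a _ => ?_
    rw [Finset.mul_sum]
    exact Finset.sum_congr rfl fun a' _ => by ring
  have hsplit : ∑ x : TorusSite d N, ∑ a : Fin k, u x a *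
      ((ε + 2 * d) * u x a + ∑ a' : Fin k, B a a' * u x a' - ∑ i : Fin d, (u (x + Pi.single i 1) a + u (x - Pi.single i 1) a)) =
      ∑ x : TorusSite d N, ∑ a : Fin k, u x a *
        ((ε + 2 * d) * u x a - ∑ i : Fin d, (u (x + Pi.single i 1) a + u (x - Pi.single i 1) a)) +
      ∑ x : TorusSite d N, ∑ a : Fin k, u x a * ∑ a' : Fin k, B a a' * u x a' := by
    rw [← Finset.sum_add_distrib]
    refine Finset.sum_congr rfl fun x _ => ?_
    rw [← Finset.sum_add_distrib]
    exact Finset.sum_congr rfl fun a _ => by ring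
  rw [hsplit]
  linarith

/-- **The Debye–Hückel operator is injective** (`ε ≥ 0`, `B ≥ b₀ > 0`): `L u = 0` forces
`b₀ Σ |u|² ≤ ⟨u, Lu⟩ = 0`, so `u = 0`. [folklore] -/
theorem debyeOp_ker_eq_zero :
    ∀ (d N k : ℕ) [NeZero N] (ε b₀ : ℝ), 0 ≤ ε → 0 < b₀ → ∀ (B : Fin k → Fin k → ℝ), (∀ w : Fin k → ℝ, b₀ * ∑ a : Fin k, w a ^ 2 ≤ ∑ a : Fin k, ∑ a' : Fin k, w a * B a a' * w a') → ∀ u : TorusSite d N → Fin k → ℝ, (∀ (x : TorusSite d N) (a : Fin k), (ε + 2 * d) * u x a + ∑ a' : Fin k, B a a' * u x a' - ∑ i : Fin d, (u (x + Pi.single i 1) a + u (x - Pi.single i 1) a) = 0) → u = 0 := by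
  intro d N k _ ε b₀ hε hb₀ B hB u hu
  have h := debyeOp_coercive d N k ε b₀ hε B hB u
  simp only [hu, mul_zero, Finset.sum_const_zero] at h
  have hU0 : 0 ≤ ∑ x : TorusSite d N, ∑ a : Fin k, u x a ^ 2 :=
    Finset.sum_nonneg fun x _ => Finset.sum_nonneg fun a _ => sq_nonneg _
  have hU : ∑ x : TorusSite d N, ∑ a : Fin k, u x a ^ 2 = 0 := by
    refine le_antisymm (le_of_not_gt fun hpos => ?_) hU0
    exact absurd h (not_le.2 (mul_pos hb₀ hpos))
  funext x a
  have hx := (Finset.sum_eq_zero_iff_of_nonneg fun x _ =>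
    Finset.sum_nonneg fun a _ => sq_nonneg (u x a)).1 hU x (Finset.mem_univ x)
  have hxa := (Finset.sum_eq_zero_iff_of_nonneg fun a _ => sq_nonneg (u x a)).1 hx a (Finset.mem_univ a)
  exact (pow_eq_zero_iff two_ne_zero).1 hxa

/-- **The Debye–Hückel vector Green's function exists**: for every site `y` and source vector
`v ∈ ℝᵏ` there is `u` with `L u = δ_y ⊗ v` (`L` is an injective linear endomorphism of the
finite-dimensional space of `ℝᵏ`-valued functions on the torus, hence surjective). [folklore] -/
theorem debyeGreen_exists :
    ∀ (d N k : ℕ) [NeZero N] (ε b₀ : ℝ), 0 ≤ ε → 0 < b₀ → ∀ (B : Fin k → Fin k → ℝ), (∀ w : Fin k → ℝ, b₀ * ∑ a : Fin k, w a ^ 2 ≤ ∑ a : Fin k, ∑ a' : Fin k, w a * B a a' * w a') → ∀ (y : TorusSite d N) (v : Fin k → ℝ), ∃ u : TorusSite d N → Fin k → ℝ, ∀ (x : TorusSite d N) (a : Fin k), (ε + 2 * d) * u x a + ∑ a' : Fin k, B a a' * u x a' - ∑ i : Fin d, (u (x + Pi.single i 1) a + u (x - Pi.single i 1) a) = if x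 = y then v a else 0 := by
  intro d N k _ ε b₀ hε hb₀ B hB y v
  let L : (TorusSite d N → Fin k → ℝ) →ₗ[ℝ] (TorusSite d N → Fin k → ℝ) :=
    { toFun := fun u x a => (ε + 2 * d) * u x a + ∑ a' : Fin k, B a a' * u x a' -
        ∑ i : Fin d, (u (x + Pi.single i 1) a + u (x - Pi.single i 1) a)
      map_add' := by
        intro u w
        funext x a
        simp only [Pi.add_apply, mul_add, Finset.sum_add_distrib]
        ring
      map_smul' := by
        intro c u
        funext x a
        simp only [Pi.smul_apply, smul_eq_mul, RingHom.id_apply, Finset.mul_sum, mul_add, mul_sub,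
          Finset.sum_add_distrib]
        refine congrArg₂ (· - ·) (congrArg₂ (· + ·) (by ring) (Finset.sum_congr rfl fun a' _ => by ring)) rfl }
  have hL : ∀ (u : TorusSite d N → Fin k → ℝ) (x : TorusSite d N) (a : Fin k),
      L u x a = (ε + 2 * d) * u x a + ∑ a' : Fin k, B a a' * u x a' -
        ∑ i : Fin d, (u (x + Pi.single i 1) a + u (x - Pi.single i 1) a) := fun u x a => rfl
  have hinj : Function.Injective L := by
    intro u w huw
    have h0 : L (u - w) = 0 := by rw [map_sub, huw, sub_self]
    refine sub_eq_zero.1 (debyeOp_ker_eq_zero d N k ε b₀ hε hb₀ B hB (u - w) fun x a => ?_)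
    have := congrFun (congrFun h0 x) a
    rwa [hL] at this
  obtain ⟨u, hu⟩ := LinearMap.surjective_of_injective hinj (fun x a => if x = y then v a else 0)
  refine ⟨u, fun x a => ?_⟩
  have := congrFun (congrFun hu x) a
  rwa [hL] at this

/-- **Exponential decay of the Debye–Hückel covariance for vector charges, uniform in the
period.** Let `ε ≥ 0`, `B ≥ b₀ > 0` (as a quadratic form) and `L u = δ_y ⊗ v` with
`(L u)(x) = (ε + 2d) u(x) + B u(x) - Σ_i (u(x+eᵢ) + u(x-eᵢ))`.  If `x_{i₀} - y_{i₀} ∈ ℤ/N` is not the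
class of any integer of modulus `< n`, then `|u(x)|² ≤ (|v|²/b₀²) (2d/(2d+b₀))^{2n}`.  Proof: the
global bound `Σ_x |u(x)|² ≤ |v|²/b₀²` (`debyeOp_coercive` + Cauchy–Schwarz), then induction on `n`
through the local equation at `x ≠ y` paired with `u(x)` and
`|Σ_{x'∼x} u(x')|² ≤ (2d)² max |u(x')|²`. [folklore] -/
theorem debyeGreen_decay :
    ∀ (d N k : ℕ) [NeZero N] (ε b₀ : ℝ), 0 ≤ ε → 0 < b₀ → ∀ (B : Fin k → Fin k → ℝ), (∀ w : Fin k → ℝ, b₀ * ∑ a : Fin k, w a ^ 2 ≤ ∑ a : Fin k, ∑ a' : Fin k, w a * B a a' * w a') → ∀ (y : TorusSite d N) (v : Fin k → ℝ) (u : TorusSite d N → Fin k → ℝ), (∀ (x : TorusSite d N) (a : Fin k), (ε + 2 * d) * u x a + ∑ a' : Fin k, B a a' * u x a' - ∑ i : Fin d, (u (x + Pi.single i 1) a + u (x - Pi.single i 1) a) = if x = y then v a else 0) → ∀ (i₀ : Fin d) (n : ℕ) (x : TorusSite d N), (∀ z : ℤ, |z| < n → x i₀ - y i₀ ≠ (z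 : ZMod N)) → ∑ a : Fin k, u x a ^ 2 ≤ (∑ a : Fin k, v a ^ 2) / b₀ ^ 2 * ((2 * d / (2 * d + b₀)) ^ 2) ^ n := by
  intro d N k _ ε b₀ hε hb₀ B hB y v u hu i₀
  -- Step 0: the global `ℓ²` bound `Σ_x |u x|² ≤ |v|² / b₀²`, from `⟨u, (-Δ + ε) u⟩ ≥ 0` and `B ≥ b₀`
  have hglob : ∀ x : TorusSite d N, ∑ a : Fin k, u x a ^ 2 ≤ (∑ a : Fin k, v a ^ 2) / b₀ ^ 2 := by
    set U : ℝ := ∑ x : TorusSite d N, ∑ a : Fin k, u x a ^ 2 with hUdef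
    -- pair the equation with `u`: coercivity on the left, the source on the right
    have hpair : ∑ x : TorusSite d N, ∑ a : Fin k, u x a *
        ((ε + 2 * d) * u x a + ∑ a' : Fin k, B a a' * u x a' - ∑ i : Fin d, (u (x + Pi.single i 1) a + u (x - Pi.single i 1) a)) =
        ∑ a : Fin k, u y a * v a := by
      rw [Finset.sum_congr rfl fun x _ => Finset.sum_congr rfl fun a _ => by rw [hu x a]]
      simp only [mul_ite, mul_zero]
      rw [Finset.sum_comm]
      refine Finset.sum_congr rfl fun a _ => ?_
      rw [Finset.sum_ite_eq' Finset.univ y, if_pos (Finset.mem_univ y)]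
    have hkey : b₀ * U ≤ ∑ a : Fin k, u y a * v a := by
      rw [← hpair, hUdef]
      exact debyeOp_coercive d N k ε b₀ hε B hB u
    -- Cauchy–Schwarz: `(Σ_a u y a v a)² ≤ |u y|² |v|² ≤ U |v|²`
    have hCS : (∑ a : Fin k, u y a * v a) ^ 2 ≤ (∑ a : Fin k, u y a ^ 2) * ∑ a : Fin k, v a ^ 2 :=
      Finset.sum_mul_sq_le_sq_mul_sq _ _ _
    have hUy : ∑ a : Fin k, u y a ^ 2 ≤ U :=
      Finset.single_le_sum (f := fun x => ∑ a : Fin k, u x a ^ 2)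
        (fun x _ => Finset.sum_nonneg fun a _ => sq_nonneg _) (Finset.mem_univ y)
    have hU0 : 0 ≤ U := Finset.sum_nonneg fun x _ => Finset.sum_nonneg fun a _ => sq_nonneg _
    have hv0 : 0 ≤ ∑ a : Fin k, v a ^ 2 := Finset.sum_nonneg fun a _ => sq_nonneg _
    have hUle : U ≤ (∑ a : Fin k, v a ^ 2) / b₀ ^ 2 := by
      rw [le_div_iff₀ (by positivity)]
      -- `b₀² U² ≤ U |v|²`
      have h1 : (b₀ * U) ^ 2 ≤ U * ∑ a : Fin k, v a ^ 2 := by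
        calc (b₀ * U) ^ 2 ≤ (∑ a : Fin k, u y a * v a) ^ 2 :=
              pow_le_pow_left₀ (by positivity) hkey 2
          _ ≤ (∑ a : Fin k, u y a ^ 2) * ∑ a : Fin k, v a ^ 2 := hCS
          _ ≤ U * ∑ a : Fin k, v a ^ 2 := mul_le_mul_of_nonneg_right hUy hv0
      rcases hU0.lt_or_eq with hUpos | hU0'
      · have : b₀ ^ 2 * U ≤ ∑ a : Fin k, v a ^ 2 := by
          have h2 : (b₀ * U) ^ 2 = (b₀ ^ 2 * U) * U := by ring
          rw [h2] at h1
          exact le_of_mul_le_mul_right (by linarith) hUpos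
        linarith
      · rw [← hU0']; simpa using hv0
    intro x
    exact (Finset.single_le_sum (f := fun x => ∑ a : Fin k, u x a ^ 2)
      (fun x _ => Finset.sum_nonneg fun a _ => sq_nonneg _) (Finset.mem_univ x)).trans hUle
  -- Step n: induction on the separation
  intro n
  induction n with
  | zero => intro x _; simpa using hglob x
  | succ n ih =>
    intro x hfar
    have hxy : x ≠ y := by
      intro h
      refine hfar 0 (by simp) ?_
      rw [h, sub_self, Int.cast_zero]
    set M : ℝ := (∑ a : Fin k, v a ^ 2) / b₀ ^ 2 * ((2 * d / (2 * d + b₀)) ^ 2) ^ n with hMdef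
    have hM0 : 0 ≤ M := by positivity
    -- neighbours are `n`-far
    have hnb : ∀ (i : Fin d) (s : ℤ), (s = 1 ∨ s = -1) →
        ∀ z : ℤ, |z| < n → (x + Pi.single i (s : ZMod N) : TorusSite d N) i₀ - y i₀ ≠ (z : ZMod N) := by
      intro i s hs z hz h
      rw [Pi.add_apply] at h
      by_cases hi : i₀ = i
      · subst hi
        rw [Pi.single_eq_same] at h
        refine hfar (z - s) ?_ ?_
        · rcases hs with rfl | rfl <;>
          · rw [abs_lt] at hz ⊢; push_cast; constructor <;> linarith
        · rw [Int.cast_sub, ← h]; ring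
      · rw [Pi.single_eq_of_ne hi, add_zero] at h
        exact hfar z (lt_of_lt_of_le hz (by exact_mod_cast n.le_succ)) h
    have hplus : ∀ i : Fin d, ∑ a : Fin k, u (x + Pi.single i 1) a ^ 2 ≤ M := by
      intro i
      have := ih (x + Pi.single i ((1 : ℤ) : ZMod N)) (hnb i 1 (Or.inl rfl))
      simpa only [Int.cast_one] using this
    have hminus : ∀ i : Fin d, ∑ a : Fin k, u (x - Pi.single i 1) a ^ 2 ≤ M := by
      intro i
      have := ih (x + Pi.single i ((-1 : ℤ) : ZMod N)) (hnb i (-1) (Or.inr rfl))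
      simpa only [Int.cast_neg, Int.cast_one, Pi.single_neg, ← sub_eq_add_neg] using this
    -- the local equation at `x ≠ y`, paired with `u x`
    set S : ℝ := ∑ a : Fin k, u x a ^ 2 with hSdef
    set r : Fin k → ℝ := fun a => ∑ i : Fin d, (u (x + Pi.single i 1) a + u (x - Pi.single i 1) a) with hrdef
    have hloc : (2 * d + b₀) * S ≤ ∑ a : Fin k, u x a * r a := by
      have h1 : ∀ a : Fin k, (ε + 2 * d) * u x a + ∑ a' : Fin k, B a a' * u x a' = r a := by
        intro a
        have := hu x a
        rw [if_neg hxy] at this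
        linarith
      have h2 : ∑ a : Fin k, u x a * r a = (ε + 2 * d) * S + ∑ a : Fin k, ∑ a' : Fin k, u x a * B a a' * u x a' := by
        rw [hSdef, Finset.mul_sum, ← Finset.sum_add_distrib]
        refine Finset.sum_congr rfl fun a _ => ?_
        rw [← h1 a, mul_add, Finset.mul_sum]
        congr 1
        · ring
        · exact Finset.sum_congr rfl fun a' _ => by ring
      have h3 := hB (u x)
      have hS0 : 0 ≤ S := Finset.sum_nonneg fun a _ => sq_nonneg _
      nlinarith
    -- `|r|² ≤ (2d)² M`
    have hr : ∑ a : Fin k, r a ^ 2 ≤ (2 * d) ^ 2 * M := by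
      have h1 : ∀ a : Fin k, r a ^ 2 ≤ 2 * d * ∑ i : Fin d, (u (x + Pi.single i 1) a ^ 2 + u (x - Pi.single i 1) a ^ 2) := by
        intro a
        calc r a ^ 2 ≤ (Finset.univ : Finset (Fin d)).card *
              ∑ i : Fin d, (u (x + Pi.single i 1) a + u (x - Pi.single i 1) a) ^ 2 := sq_sum_le_card_mul_sum_sq
          _ ≤ d * ∑ i : Fin d, 2 * (u (x + Pi.single i 1) a ^ 2 + u (x - Pi.single i 1) a ^ 2) := by
              rw [Finset.card_univ, Fintype.card_fin]
              refine mul_le_mul_of_nonneg_left (Finset.sum_le_sum fun i _ => ?_) (Nat.cast_nonneg d)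
              nlinarith [sq_nonneg (u (x + Pi.single i 1) a - u (x - Pi.single i 1) a)]
          _ = 2 * d * ∑ i : Fin d, (u (x + Pi.single i 1) a ^ 2 + u (x - Pi.single i 1) a ^ 2) := by
              rw [← Finset.mul_sum]; ring
      calc ∑ a : Fin k, r a ^ 2
          ≤ ∑ a : Fin k, 2 * d * ∑ i : Fin d, (u (x + Pi.single i 1) a ^ 2 + u (x - Pi.single i 1) a ^ 2) :=
            Finset.sum_le_sum fun a _ => h1 a
        _ = 2 * d * ∑ i : Fin d, (∑ a : Fin k, u (x + Pi.single i 1) a ^ 2 + ∑ a : Fin k, u (x - Pi.single i 1) a ^ 2) := by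
            rw [← Finset.mul_sum, Finset.sum_comm]
            congr 1
            exact Finset.sum_congr rfl fun i _ => Finset.sum_add_distrib
        _ ≤ 2 * d * ∑ _i : Fin d, (M + M) :=
            mul_le_mul_of_nonneg_left (Finset.sum_le_sum fun i _ => add_le_add (hplus i) (hminus i)) (by positivity)
        _ = (2 * d) ^ 2 * M := by
            rw [Finset.sum_const, Finset.card_univ, Fintype.card_fin, nsmul_eq_mul]; ring
    -- conclude: `(2d + b₀)² S ≤ |r|² ≤ (2d)² M`
    have hS0 : 0 ≤ S := Finset.sum_nonneg fun a _ => sq_nonneg _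
    have hCS : (∑ a : Fin k, u x a * r a) ^ 2 ≤ S * ∑ a : Fin k, r a ^ 2 := Finset.sum_mul_sq_le_sq_mul_sq _ _ _
    have hD : 0 < 2 * (d : ℝ) + b₀ := by positivity
    have hfin : (2 * d + b₀) ^ 2 * S ≤ (2 * d) ^ 2 * M := by
      rcases hS0.lt_or_eq with hSpos | hS0'
      · have h1 : ((2 * d + b₀) * S) ^ 2 ≤ S * ((2 * d) ^ 2 * M) :=
          calc ((2 * d + b₀) * S) ^ 2 ≤ (∑ a : Fin k, u x a * r a) ^ 2 :=
                pow_le_pow_left₀ (by positivity) hloc 2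
            _ ≤ S * ∑ a : Fin k, r a ^ 2 := hCS
            _ ≤ S * ((2 * d) ^ 2 * M) := mul_le_mul_of_nonneg_left hr hS0
        have h2 : ((2 * d + b₀) * S) ^ 2 = ((2 * d + b₀) ^ 2 * S) * S := by ring
        rw [h2, mul_comm S] at h1
        exact le_of_mul_le_mul_right h1 hSpos
      · rw [← hS0', mul_zero]; positivity
    have hρ : (2 * d) ^ 2 * M / (2 * d + b₀) ^ 2 = M * (2 * d / (2 * d + b₀)) ^ 2 := by
      rw [div_pow]; ring
    calc S ≤ (2 * d) ^ 2 * M / (2 * d + b₀) ^ 2 := by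
          rw [le_div_iff₀ (by positivity)]; linarith
      _ = M * (2 * d / (2 * d + b₀)) ^ 2 := hρ
      _ = (∑ a : Fin k, v a ^ 2) / b₀ ^ 2 * ((2 * d / (2 * d + b₀)) ^ 2) ^ (n + 1) := by
          rw [hMdef, pow_succ]; ring

end Summit.QuantumFields.YangMills.Theorems.AnchorGap

end
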